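import Summits.HubbardSuperconductivity.HubbardLadder.Bounds.StiffnessFromEnergyBrackets
import Literature.MathematicalPhysics.QuantumLattice.InfVolFermionStateHubbardEnergy
import Literature.MathematicalPhysics.QuantumLattice.InfVolFermionStateCompactness
import Literature.MathematicalPhysics.QuantumLattice.HubbardKineticEnergyDensity
import Literature.MathematicalPhysics.QuantumLattice.HubbardEnergyDensityVariationalPrinciple
import HarnessLib

/-!
# Ventures/CertifiedManyBodySolver — Observables: the f-sum STIFFNESS CEILING in the thermodynamic
# limit, read on TORUS-LIMIT STATES: `4 ρ_s ≤ −k(ω)`, and the ROW ADAPTER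
# "certified kinetic floor on the TL ground-state class ⇒ certified stiffness ceiling"

HONEST FRAMING: one-sided CEILINGS on the flux stiffness (helicity modulus / superfluid weight); not
a superconductivity verdict; no stiffness floor follows from equal-time data and an energy window
(cell hubbard-obs, `HOME/hubbard-obs-p2/STIFFNESS-SDP.md` §4).

Cell `hubbard-obs` (D-0042), seat p2 (stiffness), the open ★ "T6(a) TL tower" of
`HOME/hubbard-obs-p2/TARGET.md` §5 — the typing that the registry row `OBS.rhosK.tp0.TLderived`
(HOME/CERTIFIED-OBS.md, obs-ref V2 "PASS-AS-CONDITIONAL(★)") was waiting for, and the hook by which ANY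
certified thermodynamic-limit kinetic row of the programme (the chord row `OBS.kin.tp0.TLchord354x426`,
the rung-0b `kinlo` edge on the EXT5-L⁺ relaxation, …) becomes a certified STIFFNESS row with no
further input.

## Setting and what is proved (no `sorry`, no definitions, no named facts)

`E_L(θ) = fluxEnergy L U δ θ` is the lowest energy of the seam-twisted square Hubbard torus
`hubbardTorusFlux L U θ` (`t = 1`) in the `(N_L, S^z = 0)` sector, `N_L = rectN (1−δ) L = 2⌊(1−δ)L²/2⌋`.
A UNIFORM FLUX STIFFNESS is a pair `ρ_s, θ₀ > 0` with `ρ_s θ² ≤ E_L(θ) − E_L(0)` for `|θ| ≤ θ₀` and all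
even `L ≥ L₀` (the tree's hypothesis shape, `Bounds/StiffnessFromEnergyBracketsTL.lean`; tree units:
`D_s^{HVR} = ρ_s/2`, `D^{SWZ}/(πe²) = 2ρ_s`). For a state `ω` of the lattice fermion system on `ℤ²`,
`k(ω) := Σ_{i=1,2} (−1)·Σ_σ (Re ω(c†_{0σ}c_{e_iσ}) + Re ω(c†_{e_iσ}c_{0σ}))` is its kinetic energy density
(both bond directions, `t = 1`; `= ω.hubbardEnergyDensity 1 0` for translation-invariant `ω`,
`IsTranslationInvariant.hubbardEnergyDensity_eq_docc_add_hopping`) — the SAME expression as in the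
registry's kinetic rows (`m3_tp0_kineticDensity_ge_derived`, `m3_tp0_kineticDensity_ge_chord_r354_r426`).

* `four_mul_stiffness_mul_sq_le_neg_re_expect_hubbardTorus_zero` — finite `L ≥ 3`, for EVERY unit
  sector ground state `ψ`: `4 ρ_s L² ≤ −Re⟨ψ, H_L(1,0) ψ⟩ = ⟨−T⟩_ψ` (f-sum floor `ρ_s L² ≤ K_x(ψ)`
  of the Literature file `HubbardTorusFluxStiffnessResponse`, the rotation `K_y(Γ(r)φ) = K_x(φ)` of
  pub-hubbard's `StiffnessCeilingsProofs` applied to `φ = Γ(r)⁻¹ψ`, and `Re⟨ψ, H(1,0)ψ⟩ = −2(K_x + K_y)`).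
* `four_mul_fluxStiffness_le_neg_hubbardEnergyDensity_zero_of_isTorusLimitOf` — **the tower lemma**:
  if `ω` is a torus limit (weak-⋆ limit of translation-averaged states, `InfVolFermionState.IsTorusLimitOf`)
  of unit `(N_L, 0)`-sector ground states along EVEN sides `Ls → ∞`, then `4 ρ_s ≤ −ω.hubbardEnergyDensity 1 0`:
  divide by `L²`, identify `⟨ψ_L, H_L(1,0) ψ_L⟩/L²` with the averaged expectation of the pure-hopping
  mean-energy observable (`torusAvgExpect_hubbard_meanEnergyObs` at `U = 0`), pass to the limit.
* `four_mul_fluxStiffness_le_neg_kineticDensity_of_isTorusLimitOf` — the same with `k(ω)` bond by bond.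
* `fluxStiffness_le_of_torusLimit_kineticDensity_ge` — **the row adapter**: if `K ≤ k(ω)` for EVERY
  torus limit `ω` of unit `(rectN (1−δ) L, 0)`-sector ground states of `hubbardTorus 2 L 1 U` along sides
  `Ls → ∞` (the shape of a certified TL kinetic floor), then every uniform flux stiffness obeys
  `ρ_s ≤ −K/4` — unit sector ground states exist at every side (`InfVolFermionState.exists_unit_isGroundStateInSector_rectN`),
  the even sides `2(j+1)` have a torus-limit point along a subsequence
  (`InfVolFermionState.exists_isTorusLimitOf_subseq`, weak-⋆ compactness), and the tower lemma applies.
  `fluxStiffness_le_of_torusLimit_kineticDensity_ge_TT'zero` restates the class with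
  `hubbardTorusTT' L 1 0 U` (the registry's spelling, `hubbardTorusTT'_zero`).

No sign condition on `U`; `δ ≥ −1` only for the existence of the prescribed particle number.
PRIOR ART, BY NAME: the f-sum ceiling is Scalapino–White–Zhang 1993 §II / Paramekanti–Trivedi–Randeria
1998 eq. (3) / Hazra–Verma–Randeria 2019 eqs. (2)–(4); its finite-torus and energy-CHORD thermodynamic-limit
forms are pub-hubbard's `Bounds/StiffnessCeilings*.lean`, `Bounds/StiffnessFromEnergyBrackets{,TL,Sharp}.lean`
(bounds.tex Thms 1(c), 3). NEW here is only the passage through torus-limit STATES (the class on which the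
programme's observable certificates are typed) and the adapter. The Literature twin of the finite-`L` step
is `HubbardTorusFluxStiffnessIsotropic.lean` (`stiffness_mul_sq_le_quarter_docc_sub_energy`).

References: [ScalapinoWhiteZhang1993] §II; [ParamekantiTrivediRanderia1998] eq. (3); [HazraVermaRanderia2019]
eqs. (2)–(4); [BratteliRobinsonI1987] Thm 2.3.15, §4.3.1; [BratteliRobinsonII1997] §6.2.4.
-/

noncomputable section

namespace Summit.Ventures.CertifiedManyBodySolver.Observables

open Matrix Finset Filter Topology
open Literature.MathematicalPhysics.QuantumLattice
open Literature.MathematicalPhysics.QuantumLattice.ThermodynamicLimit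
open Literature.MathematicalPhysics.QuantumFieldTheory
open Literature.Probability.LatticeModels
open Summit.HubbardSuperconductivity.HubbardLadder.Bounds
open scoped ComplexOrder ComplexConjugate Topology

/-! ### Finite volume: `4 ρ_s L² ≤ ⟨−T⟩_ψ = −Re⟨ψ, H_L(1,0) ψ⟩` for every sector ground state -/

section Finite

variable {L : ℕ} [NeZero L]

/-- **The isotropic f-sum ceiling through the pure-hopping energy, for a GIVEN ground state**
(`L ≥ 3`): if `ρ_s θ² ≤ E_L(θ) − E_L(0)` for `|θ| ≤ θ₀` with `ρ_s, θ₀ > 0`, then every zero-flux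
`(N_L, 0)`-sector ground state `ψ` (unit vector) of `hubbardTorus 2 L 1 U` satisfies
`4 ρ_s L² ≤ −Re⟨ψ, H_L(1,0) ψ⟩ = 2(K_x + K_y)(ψ) = ⟨−T⟩_ψ`: the f-sum floor `ρ_s L² ≤ K_x` on `ψ` and on
the rotated ground state `Γ(r)⁻¹ψ` (`K_y(ψ) = K_x(Γ(r)⁻¹ψ)` by `kinWeightDir_one_rot`).
[cite: ScalapinoWhiteZhang1993, §II] -/
theorem four_mul_stiffness_mul_sq_le_neg_re_expect_hubbardTorus_zero (hL : 3 ≤ L) {U δ ρs θ₀ : ℝ}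
    (hρs : 0 < ρs) (hθ₀ : 0 < θ₀)
    (hst : ∀ θ : ℝ, |θ| ≤ θ₀ → ρs * θ ^ 2 ≤ fluxEnergy L U δ θ - fluxEnergy L U δ 0)
    {ψ : Fock (Orb (FermionTorus 2 L))}
    (hgs : IsGroundStateInSector (hubbardTorus 2 L 1 U) (2 * ⌊(1 - δ) * (L : ℝ) ^ 2 / 2⌋₊) 0 ψ)
    (h1 : star ψ ⬝ᵥ ψ = 1) :
    4 * (ρs * (L : ℝ) ^ 2) ≤ -(star ψ ⬝ᵥ (hubbardTorus 2 L 1 0 *ᵥ ψ)).re := by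
  -- `K_x(ψ) ≥ ρ_s L²`
  have hx : ρs * (L : ℝ) ^ 2 ≤ kinWeightDir 0 ψ :=
    (stiffness_mul_sq_le_sum_re_hop_of_isGroundStateInSector hL U δ hρs hθ₀ hst hgs h1).trans_eq
      (kinWeightX_eq_kinWeightDir ψ)
  -- `K_y(ψ) = K_x(φ) ≥ ρ_s L²` with `φ = Γ(r)⁻¹ ψ`, `Γ(r) φ = ψ`
  set Γ : Matrix (Finset (Orb (FermionTorus 2 L))) (Finset (Orb (FermionTorus 2 L))) ℂ :=
    fockMapOp (d4Orb (DihedralGroup.r 1 : DihedralGroup 4)) with hΓ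
  set φ : Fock (Orb (FermionTorus 2 L)) :=
    fockMapOp (d4Orb (DihedralGroup.r 1 : DihedralGroup 4)⁻¹) *ᵥ ψ with hφ
  have hφgs : IsGroundStateInSector (hubbardTorus 2 L 1 U) (2 * ⌊(1 - δ) * (L : ℝ) ^ 2 / 2⌋₊) 0 φ :=
    hgs.fockMapOp_d4Orb_mulVec _
  have hφ1 : star φ ⬝ᵥ φ = 1 := by
    rw [hφ, star_fockMapOp_mulVec_dotProduct_self _ (d4Orb_bijective _).injective, h1]
  have hφx : ρs * (L : ℝ) ^ 2 ≤ kinWeightDir 0 φ :=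
    (stiffness_mul_sq_le_sum_re_hop_of_isGroundStateInSector hL U δ hρs hθ₀ hst hφgs hφ1).trans_eq
      (kinWeightX_eq_kinWeightDir φ)
  have hu : Γ * Γᴴ = 1 := by
    have h := Matrix.mem_unitaryGroup_iff.1
      (fockMapOp_d4Orb_mem_unitaryGroup (L := L) (DihedralGroup.r 1 : DihedralGroup 4))
    rwa [star_eq_conjTranspose, ← hΓ] at h
  have hback : Γ *ᵥ φ = ψ := by
    rw [hφ, ← conjTranspose_fockMapOp_d4Orb, ← hΓ, mulVec_mulVec, hu, one_mulVec]
  have hy : kinWeightDir 1 ψ = kinWeightDir 0 φ := by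
    rw [← hback, hΓ]
    exact kinWeightDir_one_rot φ
  rw [re_expect_hubbardTorus_zero_eq_kin hL ψ, hy]
  linarith

end Finite

/-! ### Thermodynamic limit: the tower lemma -/

/-- **The f-sum ceiling on a uniform flux stiffness in the thermodynamic limit (tower lemma).**
Let `ρ_s, θ₀ > 0` be a uniform flux stiffness of the zero-flux `(N_L, S^z = 0)` sectors of
`hubbardTorus 2 L 1 U` along all even `L ≥ L₀` (`ρ_s θ² ≤ E_L(θ) − E_L(0)` for `|θ| ≤ θ₀`,
`E_L = fluxEnergy L U δ`). If `ω` is a torus limit (weak-⋆ limit of the translation-averaged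
states) of unit `(rectN (1−δ) L, 0)`-sector ground states `ψ (Ls j)` along EVEN sides `Ls j → ∞`, then
`4 ρ_s ≤ −ω.hubbardEnergyDensity 1 0` (minus the mean energy of the pure-hopping interaction = the kinetic
energy `⟨−T⟩` per site of `ω`). Proof: the finite-`L` ceiling `4 ρ_s L² ≤ −Re⟨ψ_L, H_L(1,0) ψ_L⟩`, the
identity `⟨ψ, H_L(1,0) ψ⟩/L² =` averaged expectation of the pure-hopping mean-energy observable
(`torusAvgExpect_hubbard_meanEnergyObs`), and `ge_of_tendsto`. Scalapino–White–Zhang's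
`D_s/(πe²) ≤ ⟨−k_x⟩`, orientation-summed, in the thermodynamic limit. [cite: ScalapinoWhiteZhang1993, §II] -/
theorem four_mul_fluxStiffness_le_neg_hubbardEnergyDensity_zero_of_isTorusLimitOf
    {ω : InfVolFermionState 2} {ψ : ∀ L, Fock (Orb (FermionTorus 2 L))} {Ls : ℕ → ℕ}
    (hω : ω.IsTorusLimitOf ψ Ls) (hLs : Tendsto Ls atTop atTop) (hEven : ∀ j, Even (Ls j))
    {U δ ρs θ₀ : ℝ} (hρs : 0 < ρs) (hθ₀ : 0 < θ₀) {L₀ : ℕ}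
    (hst : ∀ (L : ℕ) [NeZero L], L₀ ≤ L → Even L →
      ∀ θ : ℝ, |θ| ≤ θ₀ → ρs * θ ^ 2 ≤ fluxEnergy L U δ θ - fluxEnergy L U δ 0)
    (hψ : ∀ j, IsGroundStateInSector (hubbardTorus 2 (Ls j) 1 U) (rectN (1 - δ) (Ls j)) 0 (ψ (Ls j)))
    (h1 : ∀ j, star (ψ (Ls j)) ⬝ᵥ ψ (Ls j) = 1) :
    4 * ρs ≤ -ω.hubbardEnergyDensity 1 0 := by
  -- eventually along the sequence: `4 ρ_s ≤ -Re(averaged expectation of the hopping mean energy)`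
  have hev : ∀ᶠ j in atTop, 4 * ρs ≤
      -(torusAvgExpect (Ls j) (thicken ({0} : Finset (Site 2)) 1)
        ((hubbardFermionInteraction 2 1 0).meanEnergyObs 1) (ψ (Ls j))).re := by
    filter_upwards [hLs.eventually_ge_atTop (max L₀ 3)] with j hj
    have hL3 : 3 ≤ Ls j := le_trans (le_max_right _ _) hj
    have hL0 : L₀ ≤ Ls j := le_trans (le_max_left _ _) hj
    haveI : NeZero (Ls j) := ⟨by omega⟩
    have hfin := four_mul_stiffness_mul_sq_le_neg_re_expect_hubbardTorus_zero hL3 hρs hθ₀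
      (hst (Ls j) hL0 (hEven j)) (hψ j) (h1 j)
    rw [torusAvgExpect_hubbard_meanEnergyObs 1 0 hL3, ← Complex.ofReal_natCast, ← Complex.ofReal_pow,
      Complex.div_ofReal_re]
    have hLpos : (0 : ℝ) < ((Ls j : ℕ) : ℝ) ^ 2 := by positivity
    rw [← neg_div, le_div_iff₀ hLpos]
    have h4 : 4 * ρs * ((Ls j : ℕ) : ℝ) ^ 2 = 4 * (ρs * ((Ls j : ℕ) : ℝ) ^ 2) := by ring
    rw [h4]
    exact hfin
  have hlim : Tendsto (fun j => -(torusAvgExpect (Ls j) (thicken ({0} : Finset (Site 2)) 1)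
        ((hubbardFermionInteraction 2 1 0).meanEnergyObs 1) (ψ (Ls j))).re) atTop
      (𝓝 (-(ω.expect (thicken ({0} : Finset (Site 2)) 1)
        ((hubbardFermionInteraction 2 1 0).meanEnergyObs 1)).re)) :=
    ((Complex.continuous_re.tendsto _).comp (hω _ _)).neg
  exact ge_of_tendsto hlim hev

/-- **The tower lemma, bond by bond**: under the hypotheses of
`four_mul_fluxStiffness_le_neg_hubbardEnergyDensity_zero_of_isTorusLimitOf`, `4 ρ_s ≤ −k(ω)` with
`k(ω) = Σ_{i=1,2} (−1)·Σ_σ (Re ω(c†_{0σ}c_{e_iσ}) + Re ω(c†_{e_iσ}c_{0σ}))` the kinetic energy density of the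
(translation-invariant) torus limit `ω` written on the bonds `{0, e_i}` — the expression the registry's
certified kinetic rows bound. [cite: ScalapinoWhiteZhang1993, §II] -/
theorem four_mul_fluxStiffness_le_neg_kineticDensity_of_isTorusLimitOf
    {ω : InfVolFermionState 2} {ψ : ∀ L, Fock (Orb (FermionTorus 2 L))} {Ls : ℕ → ℕ}
    (hω : ω.IsTorusLimitOf ψ Ls) (hLs : Tendsto Ls atTop atTop) (hEven : ∀ j, Even (Ls j))
    {U δ ρs θ₀ : ℝ} (hρs : 0 < ρs) (hθ₀ : 0 < θ₀) {L₀ : ℕ}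
    (hst : ∀ (L : ℕ) [NeZero L], L₀ ≤ L → Even L →
      ∀ θ : ℝ, |θ| ≤ θ₀ → ρs * θ ^ 2 ≤ fluxEnergy L U δ θ - fluxEnergy L U δ 0)
    (hψ : ∀ j, IsGroundStateInSector (hubbardTorus 2 (Ls j) 1 U) (rectN (1 - δ) (Ls j)) 0 (ψ (Ls j)))
    (h1 : ∀ j, star (ψ (Ls j)) ⬝ᵥ ψ (Ls j) = 1) :
    4 * ρs ≤ -(∑ i : Fin 2, -(1 : ℝ) * ∑ σ : Fin 2,
        ((ω.expect {0, 0 + unitVec i}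
            ((cAt 0 (mem_insert_self _ _) σ)ᴴ *
              cAt (0 + unitVec i) (mem_insert_of_mem (mem_singleton_self _)) σ)).re +
          (ω.expect {0, 0 + unitVec i}
            ((cAt (0 + unitVec i) (mem_insert_of_mem (mem_singleton_self _)) σ)ᴴ *
              cAt 0 (mem_insert_self _ _) σ)).re)) := by
  have h := four_mul_fluxStiffness_le_neg_hubbardEnergyDensity_zero_of_isTorusLimitOf hω hLs hEven
    hρs hθ₀ hst hψ h1
  have hsplit := hω.isTranslationInvariant.hubbardEnergyDensity_eq_docc_add_hopping 1 0
  rw [zero_mul, zero_add] at hsplit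
  rw [← hsplit]
  exact h

/-! ### The row adapter -/

/-- **Row adapter: a certified thermodynamic-limit kinetic-energy FLOOR is a certified stiffness
CEILING.** Let `δ ≥ −1` and let `ρ_s, θ₀ > 0` be a uniform flux stiffness of the zero-flux
`(N_L, S^z = 0)` sectors of `hubbardTorus 2 L 1 U` along all even `L ≥ L₀`. If a number `K` satisfies
`K ≤ k(ω)` for EVERY torus limit `ω` of unit `(rectN (1−δ) L, S^z = 0)`-sector ground states of
`hubbardTorus 2 L 1 U` along sides `Ls → ∞` (the shape of the registry's TL kinetic rows), then
`ρ_s ≤ −K/4` (tree units; Hazra–Verma–Randeria `D_s = ρ_s/2 ≤ −K/8`; Scalapino–White–Zhang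
`D/(πe²) = 2ρ_s ≤ −K/2`). Proof: unit sector ground states exist at every side; along the even sides
`2(j+1)` a subsequence has a torus limit (weak-⋆ compactness); the tower lemma and the row apply there.
[cite: ScalapinoWhiteZhang1993, §II] -/
theorem fluxStiffness_le_of_torusLimit_kineticDensity_ge {U δ ρs θ₀ K : ℝ} (hδ : -1 ≤ δ)
    (hρs : 0 < ρs) (hθ₀ : 0 < θ₀) {L₀ : ℕ}
    (hst : ∀ (L : ℕ) [NeZero L], L₀ ≤ L → Even L →
      ∀ θ : ℝ, |θ| ≤ θ₀ → ρs * θ ^ 2 ≤ fluxEnergy L U δ θ - fluxEnergy L U δ 0)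
    (hrow : ∀ (ω : InfVolFermionState 2) (Ls : ℕ → ℕ) (ψ : ∀ L, Fock (Orb (FermionTorus 2 L))),
      Tendsto Ls atTop atTop →
      (∀ j, IsGroundStateInSector (hubbardTorus 2 (Ls j) 1 U) (rectN (1 - δ) (Ls j)) 0 (ψ (Ls j))) →
      (∀ j, star (ψ (Ls j)) ⬝ᵥ ψ (Ls j) = 1) → ω.IsTorusLimitOf ψ Ls →
      K ≤ ∑ i : Fin 2, -(1 : ℝ) * ∑ σ : Fin 2,
        ((ω.expect {0, 0 + unitVec i}
            ((cAt 0 (mem_insert_self _ _) σ)ᴴ *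
              cAt (0 + unitVec i) (mem_insert_of_mem (mem_singleton_self _)) σ)).re +
          (ω.expect {0, 0 + unitVec i}
            ((cAt (0 + unitVec i) (mem_insert_of_mem (mem_singleton_self _)) σ)ᴴ *
              cAt 0 (mem_insert_self _ _) σ)).re)) :
    ρs ≤ -K / 4 := by
  have hn2 : 1 - δ ≤ 2 := by linarith
  -- a unit sector ground state at every side
  let ψ : ∀ L, Fock (Orb (FermionTorus 2 L)) := fun L =>
    Classical.choose (InfVolFermionState.exists_unit_isGroundStateInSector_rectN 1 U hn2 L)
  have hψ1 : ∀ L, star (ψ L) ⬝ᵥ ψ L = 1 := fun L =>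
    (Classical.choose_spec (InfVolFermionState.exists_unit_isGroundStateInSector_rectN 1 U hn2 L)).1
  have hψgs : ∀ L, IsGroundStateInSector (hubbardTorus 2 L 1 U) (rectN (1 - δ) L) 0 (ψ L) := fun L =>
    (Classical.choose_spec (InfVolFermionState.exists_unit_isGroundStateInSector_rectN 1 U hn2 L)).2
  -- the even sides `2(j+1) → ∞`
  let Ls : ℕ → ℕ := fun j => 2 * (j + 1)
  have hLs : Tendsto Ls atTop atTop :=
    tendsto_atTop_mono (fun j : ℕ => (by omega : j ≤ 2 * (j + 1))) tendsto_id
  -- a torus-limit point along a subsequence (weak-⋆ compactness)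
  obtain ⟨φ, hφ, ω, hω⟩ :=
    InfVolFermionState.exists_isTorusLimitOf_subseq ψ hLs (fun j => hψ1 (Ls j))
  have hLs' : Tendsto (Ls ∘ φ) atTop atTop := hLs.comp hφ.tendsto_atTop
  have hEven : ∀ j, Even ((Ls ∘ φ) j) := fun j => even_two_mul _
  have htower := four_mul_fluxStiffness_le_neg_kineticDensity_of_isTorusLimitOf hω hLs' hEven hρs hθ₀
    hst (fun j => hψgs _) (fun j => hψ1 _)
  have hK := hrow ω (Ls ∘ φ) ψ hLs' (fun j => hψgs _) (fun j => hψ1 _) hω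
  linarith

/-- **Row adapter, registry spelling** (`hubbardTorusTT' L 1 0 U = hubbardTorus 2 L 1 U`,
`hubbardTorusTT'_zero`): the same statement with the ground-state class written over the `t–t'` torus at
`t' = 0`, exactly as the cell's certified thermodynamic-limit rows are typed
(`…Certificates.m3_tp0_kineticDensity_ge_derived`, `…_ge_chord_r354_r426`). [cite: ScalapinoWhiteZhang1993, §II] -/
theorem fluxStiffness_le_of_torusLimit_kineticDensity_ge_TT'zero {U δ ρs θ₀ K : ℝ} (hδ : -1 ≤ δ)
    (hρs : 0 < ρs) (hθ₀ : 0 < θ₀) {L₀ : ℕ}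
    (hst : ∀ (L : ℕ) [NeZero L], L₀ ≤ L → Even L →
      ∀ θ : ℝ, |θ| ≤ θ₀ → ρs * θ ^ 2 ≤ fluxEnergy L U δ θ - fluxEnergy L U δ 0)
    (hrow : ∀ (ω : InfVolFermionState 2) (Ls : ℕ → ℕ) (ψ : ∀ L, Fock (Orb (FermionTorus 2 L))),
      Tendsto Ls atTop atTop →
      (∀ j, IsGroundStateInSector (hubbardTorusTT' (Ls j) 1 0 U) (rectN (1 - δ) (Ls j)) 0 (ψ (Ls j))) →
      (∀ j, star (ψ (Ls j)) ⬝ᵥ ψ (Ls j) = 1) → ω.IsTorusLimitOf ψ Ls →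
      K ≤ ∑ i : Fin 2, -(1 : ℝ) * ∑ σ : Fin 2,
        ((ω.expect {0, 0 + unitVec i}
            ((cAt 0 (mem_insert_self _ _) σ)ᴴ *
              cAt (0 + unitVec i) (mem_insert_of_mem (mem_singleton_self _)) σ)).re +
          (ω.expect {0, 0 + unitVec i}
            ((cAt (0 + unitVec i) (mem_insert_of_mem (mem_singleton_self _)) σ)ᴴ *
              cAt 0 (mem_insert_self _ _) σ)).re)) :
    ρs ≤ -K / 4 := by
  refine fluxStiffness_le_of_torusLimit_kineticDensity_ge hδ hρs hθ₀ hst fun ω Ls ψ hLs hψ h1 hω => ?_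
  exact hrow ω Ls ψ hLs (fun j => by simpa only [hubbardTorusTT'_zero] using hψ j) h1 hω

end Summit.Ventures.CertifiedManyBodySolver.Observables

end
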